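import Summits.Ventures.LatticeQCDFlow.Exactness.ReversibleAbelFloors
import Summits.Ventures.LatticeQCDFlow.Exactness.ReversibleLocalityFloor
import Summits.Ventures.LatticeQCDFlow.Exactness.Phi4MetropolisMagnetisationMomentCSD
import Summits.Ventures.LatticeQCDFlow.Exactness.Phi4HMCPolyObsFloor
import Summits.Ventures.LatticeQCDFlow.Exactness.Phi4HMCTailRejection
import HarnessLib

/-!
# The magnetisation floors of the local and HMC arms in ABEL FORM, free of the summability hypothesis: `Σ_k ρ_M(Vk) rᵏ ≥ 1/((1 − r) + r m₂/(2χ))`, `Σ_k ρ_M(k) rᵏ ≥ 1/((1 − r) + r δ²/(2χ))`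

HONEST FRAMING: exact (Metropolis-corrected) sampling algorithms for lattice gauge theory;
figures of merit are autocorrelation/cost numbers at stated couplings and volumes; no
continuum-physics claim.  (SCALAR calibration rung S0-A: not a gauge result.)

Venture `LatticeQCDFlow` (cell pub-lqcd), topic `Exactness`; FANOUT row 2 (`s0-phi4`).  NEW WORK of
the cell: lattice instances of `Exactness/ReversibleAbelFloors.lean` for the two headline
critical-slowing-down floors of the tree — the LOCAL arm's `τ_int,sweep(M) ≥ 2χ/m₂ − ½`
(`Phi4MetropolisMagnetisationMomentCSD`, every even step density with all moments, `m₂ = ∫u²ρ`) and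
the ONE-STEP HMC arm's `τ_int(M) ≥ 2χ/δ² − ½` (`Phi4HMCPolyObsFloor`, `Phi4HMCOneStepCSD`) — now as
bounds on the ABEL SUMS of the (thinned) autocorrelation function of the magnetisation ITSELF, which
hold with NO summability and NO `ρ < 1` hypothesis (`χ = Var(M)/V`).  Nothing is cited as a fact.

## What is proved

* `RevOp.thinned_abelSum_autocorr_ge_of_carre_le` — format level: a POINTWISE carré-du-champ bound
  `K[(g − g(x))²](x) ≤ D` gives `Σ_{k≥0} ρ(Vk) rᵏ ≥ 1/((1 − r) + r V D ∫w/(2 C_g(0)))` (the pointwise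
  twin of `thinned_abelSum_autocorr_ge_of_integral_carre_le`);
* **`metropolisScan_abelSum_magnetisation_ge`** — LOCAL arm (`λ > 0`, real `J`, `ρ` even with all
  moments, `Var(M) > 0`), per sweep of `V = n+1` proposals, every `0 ≤ r < 1`:
  **`Σ_{k≥0} ρ_M(Vk) rᵏ ≥ 1 / ((1 − r) + r (n+1) m₂ / (2 Var(M)))`** (`= 1/((1 − r) + r m₂/(2χ))`);
* **`hmcPhi4_oneStep_abelSum_magnetisation_ge`** — ONE-STEP HMC (`hmcOpPhi4 J λ δ 1`, every `δ`),
  every `0 ≤ r < 1`: **`Σ_{k≥0} ρ_M(k) rᵏ ≥ 1 / ((1 − r) + r (n+1) δ² / (2 Var(M)))`**;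
* appended: `integral_magnetisation_sub_sq_mul_gibbsWeight_pos` (`∫ (M − c)² e^{−S} > 0`, via the
  far box of `Phi4HMCTailRejection`), **`gibbs_magnetisation_var_pos`** (`Var(M) > 0`), and the
  hypothesis-free forms `metropolisScan_abelSum_magnetisation_ge'`,
  `hmcPhi4_oneStep_abelSum_magnetisation_ge'`.

Reading: as `r ↑ 1` the right sides tend to `2χ/m₂` and `2χ/δ²` — the gen-13/14 floors `+ ½`; by
`ReversibleAbelFloors.tendsto_abelSum_autocorr` / `not_summable_of_abelSum_unbounded` EITHER the
autocorrelation series of `M` is not summable (infinite `τ_int`) OR `τ_int ≥ 2χ/m₂ − ½`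
(`2χ/δ² − ½`): the summability hypothesis of the printed floors is no longer load-bearing.
NOT CLAIMED: the `N ≥ 2` HMC trajectory (modulo the momentum profile, as in gen-14); the ordered
sweep.  (`Var(M) > 0`, a hypothesis of the first two lattice theorems, is DISCHARGED in the appended
section: `gibbs_magnetisation_var_pos`, and the primed theorems are hypothesis-free.)
-/

namespace Summit.Ventures.LatticeQCDFlow.Exactness

open Real MeasureTheory Filter Finset
open Summit.Ventures.LatticeQCDFlow.Scoring

namespace RevOp

variable {X : Type*} [MeasurableSpace X] {μ : Measure X} {w : X → ℝ} {A : (X → ℝ) → Prop}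
  {K : (X → ℝ) → (X → ℝ)}

/-- **Pointwise carré-du-champ bound, Abel form**: `K[(g − g(x))²](x) ≤ D` for all `x` gives
`Σ_{k≥0} ρ(Vk) rᵏ ≥ 1 / ((1 − r) + r V (D ∫ w) / (2 C_g(0)))` for every `V` and `0 ≤ r < 1`. -/
theorem thinned_abelSum_autocorr_ge_of_carre_le (hw0 : ∀ x, 0 ≤ w x) (hA1 : A (fun _ => (1 : ℝ)))
    (hAi : ∀ ⦃f h : X → ℝ⦄, A f → A h → Integrable (fun x => f x * h x * w x) μ)
    (hAc : ∀ ⦃f h : X → ℝ⦄ (c : ℝ), A f → A h → A (fun x => f x + c * h x))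
    (hAK : ∀ ⦃f : X → ℝ⦄, A f → A (K f))
    (hlin : ∀ ⦃f h : X → ℝ⦄ (c : ℝ), A f → A h →
      ∀ x, K (fun s => f s + c * h s) x = K f x + c * K h x)
    (hsymm : ∀ ⦃f h : X → ℝ⦄, A f → A h →
      ∫ x, K f x * h x * w x ∂μ = ∫ x, f x * K h x * w x ∂μ)
    (hcontr : ∀ ⦃f : X → ℝ⦄, A f → ∫ x, K f x ^ 2 * w x ∂μ ≤ ∫ x, f x ^ 2 * w x ∂μ)
    (hunit : ∀ x, K (fun _ => (1 : ℝ)) x = 1)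
    {g : X → ℝ} (hg : A g) (hg2 : A (fun x => g x ^ 2)) (hP : 0 < ∫ x, g x ^ 2 * w x ∂μ) {D : ℝ}
    (hΓ : ∀ x, K (fun y => (g y - g x) ^ 2) x ≤ D) (V : ℕ) {r : ℝ} (hr0 : 0 ≤ r) (hr1 : r < 1) :
    1 / ((1 - r) + r * (V * (D * (∫ x, w x ∂μ) / (2 * ∫ x, g x ^ 2 * w x ∂μ))))
      ≤ ∑' k, (∫ x, g x * (K^[V * k] g) x * w x ∂μ) / (∫ x, g x ^ 2 * w x ∂μ) * r ^ k := by
  have h := thinned_abelSum_autocorr_ge hw0 hAi hAc hAK hlin hsymm hcontr hg hP V hr0 hr1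
  refine le_trans ?_ h
  set P := ∫ x, g x ^ 2 * w x ∂μ with hPdef
  have hE := dirichlet_le_of_carre_le hw0 hA1 hAi hAc hAK hlin hsymm hunit hg hg2 hΓ
  have h1 : 1 - (∫ x, g x * K g x * w x ∂μ) / P ≤ D * (∫ x, w x ∂μ) / (2 * P) := by
    rw [show 1 - (∫ x, g x * K g x * w x ∂μ) / P = (P - ∫ x, g x * K g x * w x ∂μ) / P by
      field_simp, div_le_div_iff₀ hP (by positivity)]
    nlinarith
  have hρ1 : (∫ x, g x * K g x * w x ∂μ) / P ≤ 1 := by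
    rw [div_le_one hP]
    have h1' := abs_autocov_le hw0 hAi hAK hcontr hg 1
    simp only [Function.iterate_one] at h1'
    exact (le_abs_self _).trans h1'
  have hpos : 0 < (1 - r) + r * (V * (1 - (∫ x, g x * K g x * w x ∂μ) / P)) := by
    have : 0 ≤ r * (V * (1 - (∫ x, g x * K g x * w x ∂μ) / P)) :=
      mul_nonneg hr0 (mul_nonneg (Nat.cast_nonneg V) (by linarith))
    linarith
  exact one_div_le_one_div_of_le hpos (by nlinarith [mul_nonneg hr0 (Nat.cast_nonneg V)])

end RevOp

section Lattice

variable {n : ℕ}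

/-- **THE LOCAL ARM'S MAGNETISATION FLOOR IN ABEL FORM (unconditional).**  Lattice φ⁴, every
`λ > 0`, real `J`; `ρ` an even probability density with all moments (`m₂ = ∫ u² ρ`); `K` the
random-site-scan Metropolis operator, `V = n+1` proposals per sweep; `g = M − ⟨M⟩` with `Var(M) > 0`;
`ρ_M(j) = C_g(j)/C_g(0)`.  For every `0 ≤ r < 1`:
`Σ_{k≥0} ρ_M((n+1)k) rᵏ ≥ 1 / ((1 − r) + r (n+1) m₂ / (2 Var(M)))`. -/
theorem metropolisScan_abelSum_magnetisation_ge {lam : ℝ} (hlam : 0 < lam)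
    (J : Fin (n + 1) → Fin (n + 1) → ℝ) {ρ : ℝ → ℝ} (hρ0 : ∀ u, 0 ≤ ρ u) (hρm : Measurable ρ)
    (hρi : Integrable ρ) (hρ1 : ∫ u, ρ u = 1) (hρs : ∀ u, ρ (-u) = ρ u)
    (hρmom : ∀ j : ℕ, Integrable (fun u => (1 + |u|) ^ j * ρ u))
    (hvar : 0 < gibbsExpect J lam (fun φ => ((∑ y, φ y) - gibbsExpect J lam (fun ψ => ∑ y, ψ y)) ^ 2))
    {r : ℝ} (hr0 : 0 ≤ r) (hr1 : r < 1) :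
    1 / ((1 - r) + r * (((n : ℝ) + 1) * (∫ u, u ^ 2 * ρ u)
        / (2 * gibbsExpect J lam (fun φ => ((∑ y, φ y) - gibbsExpect J lam (fun ψ => ∑ y, ψ y)) ^ 2))))
      ≤ ∑' k, (∫ φ, ((∑ y, φ y) - gibbsExpect J lam (fun ψ => ∑ y, ψ y))
          * ((metroScan J lam ρ)^[(n + 1) * k]
              (fun ψ => (∑ y, ψ y) - gibbsExpect J lam (fun ψ => ∑ y, ψ y))) φ * gibbsWeight J lam φ)
          / (∫ φ, ((∑ y, φ y) - gibbsExpect J lam (fun ψ => ∑ y, ψ y)) ^ 2 * gibbsWeight J lam φ)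
          * r ^ k := by
  have hco := latticePhi4Action_coercive hlam J
  have hZ := gibbsZ_pos hlam J
  have hρ2 := integrable_sq_mul_of_moments hρ0 hρm hρmom
  set c := gibbsExpect J lam (fun ψ : Fin (n + 1) → ℝ => ∑ y, ψ y) with hc
  have hg : PolyObs (fun ψ : Fin (n + 1) → ℝ => (∑ y, ψ y) - c) := polyObs_magnetisation_sub c
  have hg2 : PolyObs (fun ψ : Fin (n + 1) → ℝ => ((∑ y, ψ y) - c) ^ 2) := polyObs_sq hg
  have hglip : ∀ (φ : Fin (n + 1) → ℝ) (x : Fin (n + 1)) (t' : ℝ),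
      |((∑ y, Function.update φ x t' y) - c) - ((∑ y, φ y) - c)| ≤ |t' - φ x| := by
    intro φ x t'
    rw [show ((∑ y, Function.update φ x t' y) - c) - ((∑ y, φ y) - c) = t' - φ x by
      rw [← sum_update_sub_sum φ x t']; ring]
  have hΓ : ∀ φ, metroScan J lam ρ (fun ψ => (((∑ y, ψ y) - c) - ((∑ y, φ y) - c)) ^ 2) φ
      ≤ ∫ u, u ^ 2 * ρ u := fun φ => metroScan_sq_dev_le_moment J lam hρ0 hρ2 φ (hglip φ)
  have hP : 0 < ∫ φ, ((∑ y, φ y) - c) ^ 2 * gibbsWeight J lam φ := by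
    have h := hvar
    rw [hc] at h ⊢
    unfold gibbsExpect at h
    exact (div_pos_iff_of_pos_right hZ).1 h
  have h := RevOp.thinned_abelSum_autocorr_ge_of_carre_le (μ := volume) (A := PolyObs)
    (K := metroScan J lam ρ) (w := gibbsWeight J lam)
    (fun φ => (gibbsWeight_pos J lam φ).le) (polyObs_const 1)
    (fun f h hf hh => polyObs_integrable_mul_mul_gibbsWeight one_pos hco hf hh)
    (fun f h c hf hh => polyObs_add_mul hf hh c)
    (fun f hf => polyObs_metroScan J lam hρ0 hρm hρmom hf)
    (fun f h c hf hh x => metroScan_add_mul_poly J lam hρ0 hρm hρmom hf hh c x)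
    (fun f h hf hh => metroScan_reversible_poly one_pos hco hρ0 hρm hρi hρ1 hρs hρmom hf hh)
    (fun f hf => metroScan_contraction_poly one_pos hco hρ0 hρm hρi hρ1 hρs hρmom hf)
    (fun φ => metroScan_one J lam hρ1 φ) hg hg2 hP hΓ (n + 1) hr0 hr1
  refine le_trans (le_of_eq ?_) h
  -- bookkeeping: `V (m₂ Z)/(2 P) = (n+1) m₂ / (2 (P/Z))`
  unfold gibbsExpect
  unfold gibbsZ at hZ ⊢
  congr 1
  congr 1
  congr 1
  push_cast
  field_simp

/-- **THE ONE-STEP HMC MAGNETISATION FLOOR IN ABEL FORM (unconditional).**  Row 2's HMC with one qpq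
leapfrog step (`hmcOpPhi4 J λ δ 1`), every `δ`, every `λ > 0`, real `J`; `g = M − ⟨M⟩` with
`Var(M) > 0`.  For every `0 ≤ r < 1`:
`Σ_{k≥0} ρ_M(k) rᵏ ≥ 1 / ((1 − r) + r (n+1) δ² / (2 Var(M)))`. -/
theorem hmcPhi4_oneStep_abelSum_magnetisation_ge {lam : ℝ} (hlam : 0 < lam)
    (J : Fin (n + 1) → Fin (n + 1) → ℝ) (δ : ℝ)
    (hvar : 0 < gibbsExpect J lam (fun φ => ((∑ y, φ y) - gibbsExpect J lam (fun ψ => ∑ y, ψ y)) ^ 2))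
    {r : ℝ} (hr0 : 0 ≤ r) (hr1 : r < 1) :
    1 / ((1 - r) + r * (((n : ℝ) + 1) * δ ^ 2
        / (2 * gibbsExpect J lam (fun φ => ((∑ y, φ y) - gibbsExpect J lam (fun ψ => ∑ y, ψ y)) ^ 2))))
      ≤ ∑' k, (∫ φ, ((∑ y, φ y) - gibbsExpect J lam (fun ψ => ∑ y, ψ y))
          * ((hmcOpPhi4 J lam δ 1)^[k]
              (fun ψ => (∑ y, ψ y) - gibbsExpect J lam (fun ψ => ∑ y, ψ y))) φ * gibbsWeight J lam φ)
          / (∫ φ, ((∑ y, φ y) - gibbsExpect J lam (fun ψ => ∑ y, ψ y)) ^ 2 * gibbsWeight J lam φ)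
          * r ^ k := by
  have hco := latticePhi4Action_coercive hlam J
  have hZ := gibbsZ_pos hlam J
  have hZp := momentumZ_pos n
  obtain ⟨C, hC1, hCg⟩ := hmcProposal_growth J lam δ 1
  have hC : 0 ≤ C := zero_le_one.trans hC1
  have hΨm := measurable_hmcProposal (Λ := Fin (n + 1)) J lam δ 1
  have hΨi := hmcProposal_involutive (Λ := Fin (n + 1)) J lam δ 1
  have hΨμ := measurePreserving_hmcProposal (Λ := Fin (n + 1)) J lam δ 1
  set c := gibbsExpect J lam (fun ψ : Fin (n + 1) → ℝ => ∑ y, ψ y) with hc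
  have hg : PolyObs (fun ψ : Fin (n + 1) → ℝ => (∑ y, ψ y) - c) := polyObs_magnetisation_sub c
  have hg2 : PolyObs (fun ψ : Fin (n + 1) → ℝ => ((∑ y, ψ y) - c) ^ 2) := polyObs_sq hg
  have hD := hmc_oneStep_msd_le one_pos hco δ
    (f := fun φ : Fin (n + 1) → ℝ => (∑ x, φ x) - c) (fun ψ φ => by
      rw [show ((∑ x, ψ x) - c) - ((∑ x, φ x) - c) = (∑ x, ψ x) - ∑ x, φ x by ring])
  -- the integrated carré du champ `≤ (n+1) δ² Z`
  have hΓ : ∫ φ, hmcOpOf J lam (hmcProposal J lam δ 1)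
        (fun ψ => (((∑ y, ψ y) - c) - ((∑ y, φ y) - c)) ^ 2) φ * gibbsWeight J lam φ
      ≤ ((n : ℝ) + 1) * δ ^ 2 * gibbsZ J lam := by
    rw [integral_hmcOpOf_sq_dev_eq_poly one_pos hco hΨm hΨμ hg, div_le_iff₀ hZp]
    calc _ ≤ ((n : ℝ) + 1) * δ ^ 2 * (momentumZ n * gibbsZ J lam) := hD
      _ = ((n : ℝ) + 1) * δ ^ 2 * gibbsZ J lam * momentumZ n := by ring
  have hP : 0 < ∫ φ, ((∑ y, φ y) - c) ^ 2 * gibbsWeight J lam φ := by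
    have h := hvar
    rw [hc] at h ⊢
    unfold gibbsExpect at h
    exact (div_pos_iff_of_pos_right hZ).1 h
  have h := RevOp.thinned_abelSum_autocorr_ge_of_integral_carre_le (μ := volume) (A := PolyObs)
    (K := hmcOpOf J lam (hmcProposal J lam δ 1)) (w := gibbsWeight J lam)
    (fun φ => (gibbsWeight_pos J lam φ).le) (polyObs_const 1)
    (fun f h hf hh => polyObs_integrable_mul_mul_gibbsWeight one_pos hco hf hh)
    (fun f h c hf hh => polyObs_add_mul hf hh c)
    (fun f hf => polyObs_hmcOpOf J lam hΨm hC hCg hf)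
    (fun f h c hf hh x => hmcOpOf_add_mul_poly J lam hΨm hC hCg hf hh c x)
    (fun f h hf hh => hmc_reversible_poly one_pos hco hΨm hΨi hΨμ hf hh)
    (fun f hf => hmcOpOf_contraction_poly one_pos hco hΨm hΨi hΨμ hC hCg hf)
    (fun φ => hmcOpOf_one J lam _ φ) hg hg2 hP hΓ 1 hr0 hr1
  simp only [one_mul, Nat.cast_one] at h
  refine le_trans (le_of_eq ?_) h
  unfold gibbsExpect
  congr 1
  congr 1
  congr 1
  field_simp

/-! ## `Var(M) > 0` discharged (appended) -/

/-- **`∫ (M − c)² e^{−S} > 0` for every `c`** (`λ > 0`, real `J`): on the far box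
`{t ≤ φ_x ≤ 2t ∀x}` with `t = |c| + 1` one has `(M − c)² ≥ 1`, and the box has positive Gibbs mass
(`Phi4HMCTailRejection.integral_boxInd_pos`). -/
theorem integral_magnetisation_sub_sq_mul_gibbsWeight_pos {lam : ℝ} (hlam : 0 < lam)
    (J : Fin (n + 1) → Fin (n + 1) → ℝ) (c : ℝ) :
    0 < ∫ φ : Fin (n + 1) → ℝ, ((∑ y, φ y) - c) ^ 2 * gibbsWeight J lam φ := by
  have hco := latticePhi4Action_coercive hlam J
  set t : ℝ := |c| + 1 with ht
  have ht0 : 0 < t := by positivity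
  have hbox := integral_boxInd_pos hlam J ht0 (n := n)
  have hg : PolyObs (fun φ : Fin (n + 1) → ℝ => (∑ y, φ y) - c) := polyObs_magnetisation_sub c
  have iM : Integrable (fun φ : Fin (n + 1) → ℝ => ((∑ y, φ y) - c) ^ 2 * gibbsWeight J lam φ) := by
    have h := polyObs_integrable_mul_mul_gibbsWeight one_pos hco hg hg
    exact h.congr (Eventually.of_forall fun φ => by simp only [sq])
  have iB : Integrable (fun φ : Fin (n + 1) → ℝ =>
      (if (∀ x, t ≤ φ x ∧ φ x ≤ 2 * t) then (1 : ℝ) else 0) * gibbsWeight J lam φ) := by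
    have h := polyObs_integrable_mul_mul_gibbsWeight one_pos hco (polyObs_of_bddObs (boxInd_bddObs t))
      (polyObs_const 1)
    exact h.congr (Eventually.of_forall fun φ => by simp only [mul_one])
  refine lt_of_lt_of_le hbox (integral_mono iB iM fun φ => ?_)
  show (if (∀ x, t ≤ φ x ∧ φ x ≤ 2 * t) then (1 : ℝ) else 0) * gibbsWeight J lam φ
    ≤ ((∑ y, φ y) - c) ^ 2 * gibbsWeight J lam φ
  refine mul_le_mul_of_nonneg_right ?_ (gibbsWeight_pos J lam φ).le
  split_ifs with hφ
  · -- on the box `Σφ ≥ (n+1) t ≥ t = |c| + 1`, so `Σφ − c ≥ 1`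
    have hsum : t ≤ ∑ y, φ y := by
      have h1 : ∑ _y : Fin (n + 1), t ≤ ∑ y, φ y := Finset.sum_le_sum fun y _ => (hφ y).1
      rw [Finset.sum_const, Finset.card_univ, Fintype.card_fin, nsmul_eq_mul] at h1
      have h2 : t ≤ ((n + 1 : ℕ) : ℝ) * t := by
        have : (1 : ℝ) ≤ ((n + 1 : ℕ) : ℝ) := by exact_mod_cast Nat.succ_le_succ (Nat.zero_le n)
        nlinarith
      exact h2.trans h1
    have hc : c ≤ |c| := le_abs_self c
    have h1 : 1 ≤ (∑ y, φ y) - c := by rw [ht] at hsum; linarith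
    nlinarith
  · exact sq_nonneg _

/-- **`Var(M) > 0`**: `⟨(M − ⟨M⟩)²⟩ > 0` for the lattice φ⁴ Gibbs law (`λ > 0`, real `J`). -/
theorem gibbs_magnetisation_var_pos {lam : ℝ} (hlam : 0 < lam) (J : Fin (n + 1) → Fin (n + 1) → ℝ) :
    0 < gibbsExpect J lam (fun φ => ((∑ y, φ y) - gibbsExpect J lam (fun ψ => ∑ y, ψ y)) ^ 2) := by
  unfold gibbsExpect
  exact div_pos (integral_magnetisation_sub_sq_mul_gibbsWeight_pos hlam J _) (gibbsZ_pos hlam J)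

/-- **THE LOCAL ARM'S MAGNETISATION FLOOR IN ABEL FORM, UNCONDITIONAL** (`Var(M) > 0` discharged):
every `λ > 0`, real `J`, `ρ` even with all moments, every `0 ≤ r < 1`:
`Σ_{k≥0} ρ_M((n+1)k) rᵏ ≥ 1 / ((1 − r) + r (n+1) m₂ / (2 Var(M)))`. -/
theorem metropolisScan_abelSum_magnetisation_ge' {lam : ℝ} (hlam : 0 < lam)
    (J : Fin (n + 1) → Fin (n + 1) → ℝ) {ρ : ℝ → ℝ} (hρ0 : ∀ u, 0 ≤ ρ u) (hρm : Measurable ρ)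
    (hρi : Integrable ρ) (hρ1 : ∫ u, ρ u = 1) (hρs : ∀ u, ρ (-u) = ρ u)
    (hρmom : ∀ j : ℕ, Integrable (fun u => (1 + |u|) ^ j * ρ u)) {r : ℝ} (hr0 : 0 ≤ r) (hr1 : r < 1) :
    1 / ((1 - r) + r * (((n : ℝ) + 1) * (∫ u, u ^ 2 * ρ u)
        / (2 * gibbsExpect J lam (fun φ => ((∑ y, φ y) - gibbsExpect J lam (fun ψ => ∑ y, ψ y)) ^ 2))))
      ≤ ∑' k, (∫ φ, ((∑ y, φ y) - gibbsExpect J lam (fun ψ => ∑ y, ψ y))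
          * ((metroScan J lam ρ)^[(n + 1) * k]
              (fun ψ => (∑ y, ψ y) - gibbsExpect J lam (fun ψ => ∑ y, ψ y))) φ * gibbsWeight J lam φ)
          / (∫ φ, ((∑ y, φ y) - gibbsExpect J lam (fun ψ => ∑ y, ψ y)) ^ 2 * gibbsWeight J lam φ)
          * r ^ k :=
  metropolisScan_abelSum_magnetisation_ge hlam J hρ0 hρm hρi hρ1 hρs hρmom
    (gibbs_magnetisation_var_pos hlam J) hr0 hr1

/-- **THE ONE-STEP HMC MAGNETISATION FLOOR IN ABEL FORM, UNCONDITIONAL** (`Var(M) > 0` discharged):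
every `δ`, `λ > 0`, real `J`, every `0 ≤ r < 1`:
`Σ_{k≥0} ρ_M(k) rᵏ ≥ 1 / ((1 − r) + r (n+1) δ² / (2 Var(M)))`. -/
theorem hmcPhi4_oneStep_abelSum_magnetisation_ge' {lam : ℝ} (hlam : 0 < lam)
    (J : Fin (n + 1) → Fin (n + 1) → ℝ) (δ : ℝ) {r : ℝ} (hr0 : 0 ≤ r) (hr1 : r < 1) :
    1 / ((1 - r) + r * (((n : ℝ) + 1) * δ ^ 2
        / (2 * gibbsExpect J lam (fun φ => ((∑ y, φ y) - gibbsExpect J lam (fun ψ => ∑ y, ψ y)) ^ 2))))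
      ≤ ∑' k, (∫ φ, ((∑ y, φ y) - gibbsExpect J lam (fun ψ => ∑ y, ψ y))
          * ((hmcOpPhi4 J lam δ 1)^[k]
              (fun ψ => (∑ y, ψ y) - gibbsExpect J lam (fun ψ => ∑ y, ψ y))) φ * gibbsWeight J lam φ)
          / (∫ φ, ((∑ y, φ y) - gibbsExpect J lam (fun ψ => ∑ y, ψ y)) ^ 2 * gibbsWeight J lam φ)
          * r ^ k :=
  hmcPhi4_oneStep_abelSum_magnetisation_ge hlam J δ (gibbs_magnetisation_var_pos hlam J) hr0 hr1

end Lattice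

end Summit.Ventures.LatticeQCDFlow.Exactness
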